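import Summits.SmoothPoincare4.SmoothPoincare4.Theses.LipschitzHauptvermutung

/-!
# Birth skeleton — crux `LipStandard` (item `stmt-SmoothPoincare4-18748`), line `birth`

Route `route-SmoothPoincare4-LipschitzHauptvermutung` ("Lipschitz Hauptvermutung for homotopy 4-spheres, then
Clarke regularisation to a diffeomorphism"), rank-2 crux
`Summit.SmoothPoincare4.SmoothPoincare4.Theses.LipschitzHauptvermutung.LipStandard`:

> every Hausdorff second-countable `C^∞` 4-manifold `M` (modelled on `ℝ⁴`) with `M ≃ₕ S⁴` admits a homeomorphism
> `h : M ≃ₜ S⁴` such that `h` and `h.symm` are locally Lipschitz read in the extended charts `(𝓡 4)` at every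
> point ("the Lipschitz structure underlying the smooth structure of a homotopy 4-sphere is standard").

THE LINE is the route header's two-layer plan `LipStandard ⇐ stub_almostLipStandard → stub_ballRemovability`,
re-materialised verbatim (same stub names, same signatures) from the skeleton registered at the route's birth by
`planner-type-fe1c30e820-0` (skeleton sha `1f407dc7…`, vetted PASS by `refuter-skel-stmt-SmoothPoincare4-18748-vet-0`,
2026-08-17: sorries = stubs = 2, probes stub → crux / stub → summit failed 4/4) — that unit could not `crux write`,
so this file is the tree-resident copy:

* `stub_almostLipStandard` (THE HEART — quantitative topological Hauptvermutung; open, size XL): every smooth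
  homotopy 4-sphere `M` admits a homeomorphism `h : M ≃ₜ S⁴` such that, at every point of `M` (resp. of `S⁴`),
  the chart representative of `h` (resp. `h.symm`) is continuous on a small chart ball and locally `L`-Lipschitz
  at every point of that ball OFF a closed `μH[3]`-null exceptional set `K`, with ONE constant `L` for the ball.
  Intended construction: Freedman's homeomorphism improved by Quinn-type handle smoothing (Freedman–Quinn 1990,
  §8) with uniform metric control off a codimension-one-null singular set; the uniformity of `L` across `K` is
  exactly what no printed theorem provides (Donaldson–Sullivan 1989: LIP ≠ TOP in dimension 4, so the control
  must use `M ≃ₕ S⁴`). Honest status (vet advisory carried forward): modulo the elementary stub below this stub is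
  EQUIVALENT to the crux (take `K = ∅` conversely) — it fixes the FORM in which the geometric input must arrive
  (uniform `L`, `H³`-null closed singular set, no continuity loss), and a tenure re-split of it is expected rather
  than a direct close.
* `stub_ballRemovability` (pure real analysis on `ℝ⁴`; a THEOREM, size M; the route's cheapest falsifier): a map
  `f : ℝ⁴ → ℝ⁴` continuous on an open ball and locally `L`-Lipschitz near every point of the ball off a closed
  `μH[3]`-null set `K` is `L`-Lipschitz on the whole ball. Proof sketch (vet): for `x, y` in the ball project `K`
  to the hyperplane `v^⊥`, `v = y - x`; the projection is Lipschitz so its image is `H³`-null, hence almost every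
  segment parallel to `[x, y]` misses `K`; along such a segment local `L`-Lipschitz ⇒ `L`-Lipschitz (compactness
  chaining on a convex set), and continuity of `f` passes to the limit segment. (`IsClosed K` is not needed.)

`LipStandard_of : stub_ballRemovability-sig → stub_almostLipStandard-sig → LipStandard` is the REAL composition
(sorry-free, pure logic): the heart gives `h` and, per point, `L r K` with the local data; removability upgrades it
to `LipschitzOnWith L (writtenInExtChartAt …) (ball … r)`, and a ball of positive radius is a neighbourhood of the
chart image of the point — which is `LocallyLipschitzInCharts` for `h` and for `h.symm`. Its hypotheses are the
stub statements under the name-keyed aliases `Registered.stub_*`; the closing `example : LipStandard` wires the two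
sorried stubs into it. `sorry` occurs ONLY in the two `stub_*` theorems.

Disproof used: none — `ledger crux ls stmt-SmoothPoincare4-18748` shows no workfiles (no `Disproof.lean`, no
`_false_without_` theorem, no `Theorems/LipStandard/Negative/*`) at registration (2026-08-17); negatives index
(`ledger negatives --problem SmoothPoincare4`): 0 refuted statements. Load-bearing hypotheses honoured: the
homotopy equivalence `M ≃ₕ S⁴` enters ONLY the heart (without it the statement is false: `M = ℝP⁴` or
`S² × S²` is not even homeomorphic to `S⁴`); dimension 4 is where the statement has content (Sullivan 1979: in
dimension ≠ 4 every homeomorphism of smooth manifolds is isotopic to a bi-Lipschitz one). Barriers: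
TopologicalBarrierFour evaded (the conclusion is a LIP statement about the smooth atlas, not a TOP invariant);
GaugeSumBarrierFour / StableBarrierFour / HCobordism(Invariant)BarrierFour not engaged (no gauge invariant, no
stabilisation, no h-cobordism step — NB the LIP 5-dimensional h-cobordism "theorem" is false by
Donaldson–Sullivan, so the heart must not route through `Θ₄ = 0`); OpenAnalogueBarrierFour respected (compact `M`
only; nothing is claimed about `M ∖ {pt}` or exotic `ℝ⁴`s).
-/

set_option linter.dupNamespace false

noncomputable section

open scoped Manifold ContDiff Topology NNReal MeasureTheory ENNReal ContinuousMap
open Set Function Filter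

namespace Summit.SmoothPoincare4.SmoothPoincare4.Cruxes.LipStandard.Birth

open Summit.SmoothPoincare4.SmoothPoincare4.Theses.LipschitzHauptvermutung (LipStandard)
open Literature.Geometry.Manifold

/-- Local notation: the model space `ℝ⁴ = EuclideanSpace ℝ (Fin 4)`. -/
local notation "𝔼4" => EuclideanSpace ℝ (Fin 4)

/-- Local notation: the standard unit sphere `S⁴ ⊂ ℝ⁵` with Mathlib's `(𝓡 4)` manifold structure. -/
local notation "𝕊⁴" => (Metric.sphere (0 : EuclideanSpace ℝ (Fin 5)) 1)

/-! ## The two registered stubs -/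

/-- **Stub 1 (THE HEART) — almost-Lipschitz standardness of smooth homotopy 4-spheres.**
For every Hausdorff second-countable smooth 4-manifold `M` (modelled on `ℝ⁴`, no boundary) homotopy equivalent
to `S⁴` there is a homeomorphism `h : M ≃ₜ S⁴` such that for every `x : M` there are a constant `L`, a radius
`r > 0` and a closed `μH[3]`-null set `K ⊂ ℝ⁴` with: the chart representative
`writtenInExtChartAt (𝓡 4) (𝓡 4) x h` is continuous on the chart ball `ball (extChartAt (𝓡 4) x x) r` and
locally `L`-Lipschitz at every point of that ball outside `K`; and the same for `h.symm` at every `x : S⁴`.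
Why plausibly true: Freedman gives the homeomorphism, Quinn's smoothing theory (Freedman–Quinn 1990 §8) makes
homeomorphisms of smooth 4-manifolds nice off small singular sets, and for a homotopy sphere no LIP/QC gauge
obstruction exists (`b₂ = 0`; Donaldson–Sullivan 1989 Thms 1–2 are vacuous here). Why it might fail: an exotic
`S⁴` could carry an exotic Lipschitz structure (LIP ≠ TOP in dimension 4, Donaldson–Sullivan 1989), and no
printed theorem gives the UNIFORM constant `L` across the singular set. Size: XL (open; crux-equivalent modulo
`stub_ballRemovability` — see the module docstring).
[cite: FreedmanQuinn1990, §8.1] [cite: DonaldsonSullivanActa1989, Theorems 1–2]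
[cite: Sullivan1979Hyperbolic, Theorem 2 and Corollary 3] -/
theorem stub_almostLipStandard :
    ∀ (M : Type) [TopologicalSpace M] [T2Space M] [SecondCountableTopology M]
      [ChartedSpace (EuclideanSpace ℝ (Fin 4)) M] [IsManifold (𝓡 4) ∞ M], (M ≃ₕ 𝕊⁴) →
      ∃ h : M ≃ₜ 𝕊⁴,
        (∀ x : M, ∃ (L : ℝ≥0) (r : ℝ) (K : Set 𝔼4), 0 < r ∧ IsClosed K ∧ μH[3] K = 0 ∧
          ContinuousOn (writtenInExtChartAt (𝓡 4) (𝓡 4) x h) (Metric.ball (extChartAt (𝓡 4) x x) r) ∧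
          ∀ y ∈ Metric.ball (extChartAt (𝓡 4) x x) r \ K, ∃ s ∈ 𝓝 y,
            LipschitzOnWith L (writtenInExtChartAt (𝓡 4) (𝓡 4) x h) s) ∧
        (∀ x : 𝕊⁴, ∃ (L : ℝ≥0) (r : ℝ) (K : Set 𝔼4), 0 < r ∧ IsClosed K ∧ μH[3] K = 0 ∧
          ContinuousOn (writtenInExtChartAt (𝓡 4) (𝓡 4) x h.symm) (Metric.ball (extChartAt (𝓡 4) x x) r) ∧
          ∀ y ∈ Metric.ball (extChartAt (𝓡 4) x x) r \ K, ∃ s ∈ 𝓝 y,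
            LipschitzOnWith L (writtenInExtChartAt (𝓡 4) (𝓡 4) x h.symm) s) := by
  sorry

/-- **Stub 2 — removability of closed `H³`-null sets for uniformly locally Lipschitz continuous maps of `ℝ⁴`.**
If `f : ℝ⁴ → ℝ⁴` is continuous on the open ball `ball c r`, `K` is closed with `μH[3] K = 0`, and `f` is
locally `L`-Lipschitz at every point of `ball c r ∖ K`, then `f` is `L`-Lipschitz on `ball c r`.
Why plausibly true: it is a theorem of real analysis — for `x, y` in the ball, almost every segment parallel to
`[x, y]` misses `K` (orthogonal projection is Lipschitz, so the shadow of `K` on `(y - x)^⊥ ≅ ℝ³` is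
`H³ = Lebesgue`-null), local `L`-Lipschitz along a segment chains to `L`-Lipschitz by compactness and convexity,
and continuity on the ball passes the estimate to the limit. Size: M (formal: Hausdorff measure under Lipschitz
maps `MeasureTheory.Measure.hausdorffMeasure_image_le`-type bounds, `H³ = λ³` on a hyperplane, segment chaining).
[cite: DonaldsonSullivanActa1989, Introduction] -/
theorem stub_ballRemovability :
    ∀ (f : 𝔼4 → 𝔼4) (c : 𝔼4) (r : ℝ) (K : Set 𝔼4) (L : ℝ≥0), ContinuousOn f (Metric.ball c r) →
      IsClosed K → μH[3] K = 0 → (∀ y ∈ Metric.ball c r \ K, ∃ s ∈ 𝓝 y, LipschitzOnWith L f s) →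
      LipschitzOnWith L f (Metric.ball c r) := by
  sorry

/-! ## Name-keyed aliases of the two stub statements (hypotheses of the composition) -/
namespace Registered

/-- Alias: the signature of `stub_almostLipStandard`. -/
abbrev stub_almostLipStandard : Prop :=
    ∀ (M : Type) [TopologicalSpace M] [T2Space M] [SecondCountableTopology M]
      [ChartedSpace (EuclideanSpace ℝ (Fin 4)) M] [IsManifold (𝓡 4) ∞ M], (M ≃ₕ 𝕊⁴) →
      ∃ h : M ≃ₜ 𝕊⁴,
        (∀ x : M, ∃ (L : ℝ≥0) (r : ℝ) (K : Set 𝔼4), 0 < r ∧ IsClosed K ∧ μH[3] K = 0 ∧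
          ContinuousOn (writtenInExtChartAt (𝓡 4) (𝓡 4) x h) (Metric.ball (extChartAt (𝓡 4) x x) r) ∧
          ∀ y ∈ Metric.ball (extChartAt (𝓡 4) x x) r \ K, ∃ s ∈ 𝓝 y,
            LipschitzOnWith L (writtenInExtChartAt (𝓡 4) (𝓡 4) x h) s) ∧
        (∀ x : 𝕊⁴, ∃ (L : ℝ≥0) (r : ℝ) (K : Set 𝔼4), 0 < r ∧ IsClosed K ∧ μH[3] K = 0 ∧
          ContinuousOn (writtenInExtChartAt (𝓡 4) (𝓡 4) x h.symm) (Metric.ball (extChartAt (𝓡 4) x x) r) ∧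
          ∀ y ∈ Metric.ball (extChartAt (𝓡 4) x x) r \ K, ∃ s ∈ 𝓝 y,
            LipschitzOnWith L (writtenInExtChartAt (𝓡 4) (𝓡 4) x h.symm) s)

/-- Alias: the signature of `stub_ballRemovability`. -/
abbrev stub_ballRemovability : Prop :=
    ∀ (f : 𝔼4 → 𝔼4) (c : 𝔼4) (r : ℝ) (K : Set 𝔼4) (L : ℝ≥0), ContinuousOn f (Metric.ball c r) →
      IsClosed K → μH[3] K = 0 → (∀ y ∈ Metric.ball c r \ K, ∃ s ∈ 𝓝 y, LipschitzOnWith L f s) →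
      LipschitzOnWith L f (Metric.ball c r)

end Registered

/-! ## The composition (kernel-checked, sorry-free) -/

/-- **Skeleton theorem — the crux BY NAME from the two stubs.** Given the binders of `LipStandard` (`M` with the
summit's instances and `e : M ≃ₕ S⁴`): the heart yields a homeomorphism `h : M ≃ₜ S⁴` with, at each point of `M`
and of `S⁴`, a chart ball of radius `r > 0`, a constant `L` and a closed `μH[3]`-null exceptional set off which
the chart representative of `h` (resp. `h.symm`) is locally `L`-Lipschitz and on which it is continuous;
removability makes it `L`-Lipschitz on the whole ball, a neighbourhood of the chart image of the point — i.e.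
`LocallyLipschitzInCharts (𝓡 4) (𝓡 4) h` and `… h.symm`. Pure logic; no choice beyond the stubs.
[cite: DonaldsonSullivanActa1989, Introduction] -/
theorem LipStandard_of :
    Registered.stub_ballRemovability → Registered.stub_almostLipStandard → LipStandard := by
  intro hR hA M _ _ _ _ _ e
  obtain ⟨h, hM, hS⟩ := hA M e
  refine ⟨h, ?_, ?_⟩
  · intro x
    obtain ⟨L, r, K, hr, hK, hK0, hcont, hloc⟩ := hM x
    exact ⟨L, Metric.ball (extChartAt (𝓡 4) x x) r, Metric.ball_mem_nhds _ hr,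
      hR _ _ r K L hcont hK hK0 hloc⟩
  · intro x
    obtain ⟨L, r, K, hr, hK, hK0, hcont, hloc⟩ := hS x
    exact ⟨L, Metric.ball (extChartAt (𝓡 4) x x) r, Metric.ball_mem_nhds _ hr,
      hR _ _ r K L hcont hK hK0 hloc⟩

/-- Wiring check: the two registered stubs feed `LipStandard_of` exactly as stated (aliases = signatures), so the
skeleton is `LipStandard` closed modulo the stubs; sorries enter only through them. -/
example : LipStandard :=
  LipStandard_of stub_ballRemovability stub_almostLipStandard

end Summit.SmoothPoincare4.SmoothPoincare4.Cruxes.LipStandard.Birth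

end
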